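import Mathlib
import Literature.Analysis.FluidPDE.ConstantinSmallViscosityProofs

/-!
# Fluid computer — the INVISCID-LIMIT CEILING of the R2 amplitude rung: 'a machine must be visible in Euler'

HONEST FRAMING (cell `pub-fluidc`, verbatim): *low prior, high value-of-information experiment on Tao's
machine paradigm; NOT a claim that NS blows up.* This file is on the THEOREM side of the cell (what every
cascade design must respect); nothing here is evidence of blow-up.

Provenance: cell `pub-fluidc`, seat idea-2 gen 8, card O9 (`HOME/pub-fluidc-idea-2/CARD-O9-inviscid-ceiling.md`,
`HOME/atlas/IDEA-2.md` §12). The amplitude rung tabulates, per energy-transfer step of scale ratio `λ` and per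
initial datum, the band sup-velocity gain `g = U_out/U_in` and the level-Reynolds ratio `r = g/λ` against the
machine floor `r ≥ 1`. Card O9 adds the EULER TWIN of each datum as the `Re → ∞` value of these observables:
by the inviscid-limit theorem without boundary (Swann 1971, Kato 1972, Constantin 1986, Masmoudi 2007) the
Navier–Stokes solutions with the SAME datum converge to the Euler solution uniformly on Euler's smooth window,
so a datum whose Euler twin steps below the floor on a trusted window cannot be rescued by raising the Reynolds
number there.

Contents.
* `l2_close_of_constantin1986` — the analytic input in the tree's own vocabulary: the `n = 0` (`L²`) case of
  Constantin 1986, Thm. 1.1 on `ℝ³` [cite: Constantin1986, Thm. 1.1], read off the PROVED tree theorem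
  `Literature.Analysis.FluidPDE.constantin_small_viscosity_holds`: `∫ |u^ν(t) − U(t)|² ≤ (C ν)²` on `[0,T]` for
  all `0 < ν ≤ ν₀`, same datum.
* The logic of the transfer for one real level observable `g ν` of a fixed datum with Euler value `gE`
  (hypothesis: `g ν → gE` as `ν → 0⁺`, which is what the closeness gives for any `L²`-continuous observable on a
  window inside `[0,T]`): `eventually_below_floor`, `floor_visible_in_euler` (the contrapositive: floor steps for
  arbitrarily small `ν` force the Euler twin to be at/above the floor), `eventually_r_lt_one`, the quantitative
  `below_floor_of_rate` (rate `K ν` ⇒ explicit viscosity threshold) and the bookkeeping `below_floor_of_ceiling`;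
  `visible_in_euler_of_tendsto` states the contrapositive for an arbitrary observable `Φ` of a velocity slice.
* Richardson-in-`ν` (the cell's ask A2′): `extrapolant_error_of_rate` — with ONLY an `O(ν)` bound the two-point
  linear extrapolant to `ν = 0` is certified no better than `K ν₂ · 2ν₁/(ν₁ − ν₂)`; `extrapolant_error_of_expansion`
  — with a second-order expansion `|g ν − gE − a ν| ≤ B ν²` the linear term cancels and the error is
  `B ν₁ ν₂ (ν₁ + ν₂)/(ν₁ − ν₂)`.

Only Mathlib and the tree's Constantin file are used; no new definitions.
-/

namespace Summit.NavierStokesRegularity.FluidComputer.InviscidCeiling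

open Filter Topology

/-- If the Euler twin's level gain `gE` is strictly below the floor value `lam` (i.e. `r_E < 1`) and the viscous
gains converge to it as `ν → 0⁺`, then the gain of every sufficiently small viscosity is below the floor, for the
same initial datum. [cite: Constantin1986, Thm. 1.1] -/
theorem eventually_below_floor {g : ℝ → ℝ} {gE lam : ℝ}
    (h : Tendsto g (𝓝[>] (0 : ℝ)) (𝓝 gE)) (hE : gE < lam) :
    ∀ᶠ ν in 𝓝[>] (0 : ℝ), g ν < lam :=
  h.eventually (eventually_lt_nhds hE)

/-- 'A machine must be visible in Euler': if floor steps `lam ≤ g ν` occur for arbitrarily small viscosities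
(as they must along any `ν`-family of would-be machines at a fixed datum), then the Euler twin itself has
`lam ≤ gE`. Contrapositive of `eventually_below_floor`. [cite: Constantin1986, Thm. 1.1] -/
theorem floor_visible_in_euler {g : ℝ → ℝ} {gE lam : ℝ}
    (h : Tendsto g (𝓝[>] (0 : ℝ)) (𝓝 gE)) (hf : ∃ᶠ ν in 𝓝[>] (0 : ℝ), lam ≤ g ν) :
    lam ≤ gE := by
  by_contra hlt
  exact hf ((eventually_below_floor h (lt_of_not_ge hlt)).mono fun ν hν => not_le.mpr hν)

/-- The same in the rung's ratio `r = g / lam` (for `lam > 0`): an Euler twin with `r_E < 1` forces `r < 1`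
for all small viscosities. [cite: Constantin1986, Thm. 1.1] -/
theorem eventually_r_lt_one {g : ℝ → ℝ} {gE lam : ℝ} (hlam : 0 < lam)
    (h : Tendsto g (𝓝[>] (0 : ℝ)) (𝓝 gE)) (hE : gE / lam < 1) :
    ∀ᶠ ν in 𝓝[>] (0 : ℝ), g ν / lam < 1 := by
  have hE' : gE < lam := by rwa [div_lt_one hlam] at hE
  exact (eventually_below_floor h hE').mono fun ν hν => (div_lt_one hlam).mpr hν

/-- Quantitative form (rate `|g ν - gE| ≤ K ν` on `0 < ν ≤ ν₀`, the shape of Constantin's / Masmoudi's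
estimate): an explicit viscosity below which the step stays under the floor, namely `K ν < lam - gE`.
[cite: Constantin1986, Thm. 1.1] -/
theorem below_floor_of_rate {g : ℝ → ℝ} {gE lam K ν₀ ν : ℝ}
    (hrate : ∀ μ, 0 < μ → μ ≤ ν₀ → |g μ - gE| ≤ K * μ)
    (hν : 0 < ν) (hν₀ : ν ≤ ν₀) (hsmall : K * ν < lam - gE) :
    g ν < lam := by
  have h1 : g ν - gE ≤ K * ν := le_trans (le_abs_self _) (hrate ν hν hν₀)
  linarith

/-- Bookkeeping used by the cell's registered ceiling test: if along a family `S` of viscosities the gain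
never exceeds the Euler value by more than a factor `1 + ε`, an Euler twin with `(1 + ε) * gE < lam` excludes
a floor step at EVERY viscosity of the family, not only eventually. -/
theorem below_floor_of_ceiling {g : ℝ → ℝ} {gE lam ε : ℝ} {S : Set ℝ}
    (hceil : ∀ ν ∈ S, g ν ≤ (1 + ε) * gE) (hE : (1 + ε) * gE < lam) :
    ∀ ν ∈ S, g ν < lam :=
  fun ν hν => lt_of_le_of_lt (hceil ν hν) hE

section TreeAnchor

open MeasureTheory Set Literature.Analysis.FluidPDE

/-- **`L²` inviscid closeness on Euler's window (`ℝ³`, classical, same datum) — the `n = 0` case of the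
TREE THEOREM `constantin_small_viscosity_holds` (Constantin 1986, Thm. 1.1).** If `(U, P)` is a classical
Euler solution on `[0,T] × ℝ³` in the Beale–Kato–Majda class from a rapidly decaying datum, then there are
`ν₀ > 0` and `C` such that for every `0 < ν ≤ ν₀` a classical Navier–Stokes solution `u` with viscosity `ν`
and the same datum exists on `[0,T]` and `∫ |u(t,x) − U(t,x)|² dx ≤ (C ν)²` for all `t ∈ [0,T]`.
[cite: Constantin1986, Thm. 1.1] -/
theorem l2_close_of_constantin1986 {T : ℝ} (hT : 0 < T)
    {U : ℝ → EuclideanSpace ℝ (Fin 3) → EuclideanSpace ℝ (Fin 3)} {P : ℝ → EuclideanSpace ℝ (Fin 3) → ℝ}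
    (hE : IsClassicalEulerSolutionOn (Icc 0 T) 0 U P) (hB : HasBoundedSobolevNormsOn (Icc 0 T) U)
    (hd : HasRapidSpatialDecay (U 0)) :
    ∃ ν₀ : ℝ, 0 < ν₀ ∧ ∃ C : ℝ, ∀ ν : ℝ, 0 < ν → ν ≤ ν₀ →
      ∃ (u : ℝ → EuclideanSpace ℝ (Fin 3) → EuclideanSpace ℝ (Fin 3))
        (p : ℝ → EuclideanSpace ℝ (Fin 3) → ℝ),
        IsClassicalNSSolutionOn (Icc 0 T) ν 0 u p ∧ u 0 = U 0 ∧
          ∀ t ∈ Icc 0 T, ∫⁻ x, ‖u t x - U t x‖ₑ ^ 2 ≤ ENNReal.ofReal (C * ν) ^ 2 := by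
  obtain ⟨ν₀, hν₀, C, hC⟩ := constantin_small_viscosity_holds 3 le_rfl T hT U P hE hB hd
  refine ⟨ν₀, hν₀, C, fun ν hν hνν₀ => ?_⟩
  obtain ⟨u, p, hu, -, h0, hest⟩ := hC ν hν hνν₀
  refine ⟨u, p, hu, h0, fun t ht => ?_⟩
  have hpt : ∀ x, ‖u t x - U t x‖ₑ = ‖iteratedFDeriv ℝ 0 (u t - U t) x‖ₑ := by
    intro x
    rw [← ofReal_norm, ← ofReal_norm, norm_iteratedFDeriv_zero, Pi.sub_apply]
  calc ∫⁻ x, ‖u t x - U t x‖ₑ ^ 2 = ∫⁻ x, ‖iteratedFDeriv ℝ 0 (u t - U t) x‖ₑ ^ 2 :=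
        lintegral_congr fun x => by rw [hpt x]
    _ ≤ ENNReal.ofReal (C * ν) ^ 2 := hest t ht 0 (Nat.zero_le _)

/-- The O9 reading for an arbitrary real observable `Φ` of a velocity slice that is continuous along the
inviscid limit (`Φ (u^ν t) → Φ (U t)` as `ν → 0⁺`, e.g. an `L²`-Lipschitz functional by
`l2_close_of_constantin1986`): floor events `lam ≤ Φ (u^ν t)` for arbitrarily small `ν` force `lam ≤ Φ (U t)`.
[cite: Constantin1986, Thm. 1.1] -/
theorem visible_in_euler_of_tendsto {V : Type*} (Φ : V → ℝ) (uν : ℝ → V) (UE : V) {lam : ℝ}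
    (h : Tendsto (fun ν => Φ (uν ν)) (𝓝[>] (0 : ℝ)) (𝓝 (Φ UE)))
    (hf : ∃ᶠ ν in 𝓝[>] (0 : ℝ), lam ≤ Φ (uν ν)) : lam ≤ Φ UE :=
  floor_visible_in_euler (g := fun ν => Φ (uν ν)) h hf

end TreeAnchor

section Richardson

/-- Richardson-in-`ν` with ONLY an `O(ν)` bound: if `|gᵢ - gE| ≤ K νᵢ` at `0 < ν₂ < ν₁`, the linear
extrapolant `g₂ + (g₂ - g₁) ν₂/(ν₁ - ν₂)` is certified only to `K ν₂ · 2ν₁/(ν₁ - ν₂)` (= `4 K ν₂` at factor-2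
spacing): without a second-order expansion, extrapolation does not beat the smallest-viscosity run. -/
theorem extrapolant_error_of_rate {K ν₁ ν₂ g₁ g₂ gE : ℝ} (h₂ : 0 < ν₂) (h₁₂ : ν₂ < ν₁)
    (e₁ : |g₁ - gE| ≤ K * ν₁) (e₂ : |g₂ - gE| ≤ K * ν₂) :
    |g₂ + (g₂ - g₁) * (ν₂ / (ν₁ - ν₂)) - gE| ≤ K * ν₂ * (2 * ν₁ / (ν₁ - ν₂)) := by
  have hd : 0 < ν₁ - ν₂ := sub_pos.mpr h₁₂
  have hθ : 0 ≤ ν₂ / (ν₁ - ν₂) := div_nonneg h₂.le hd.le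
  have hid : g₂ + (g₂ - g₁) * (ν₂ / (ν₁ - ν₂)) - gE
      = (1 + ν₂ / (ν₁ - ν₂)) * (g₂ - gE) - (ν₂ / (ν₁ - ν₂)) * (g₁ - gE) := by ring
  rw [hid]
  calc |(1 + ν₂ / (ν₁ - ν₂)) * (g₂ - gE) - (ν₂ / (ν₁ - ν₂)) * (g₁ - gE)|
      ≤ |(1 + ν₂ / (ν₁ - ν₂)) * (g₂ - gE)| + |(ν₂ / (ν₁ - ν₂)) * (g₁ - gE)| := abs_sub _ _
    _ = (1 + ν₂ / (ν₁ - ν₂)) * |g₂ - gE| + (ν₂ / (ν₁ - ν₂)) * |g₁ - gE| := by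
        rw [abs_mul, abs_mul, abs_of_nonneg (by linarith), abs_of_nonneg hθ]
    _ ≤ (1 + ν₂ / (ν₁ - ν₂)) * (K * ν₂) + (ν₂ / (ν₁ - ν₂)) * (K * ν₁) :=
        add_le_add (mul_le_mul_of_nonneg_left e₂ (by linarith)) (mul_le_mul_of_nonneg_left e₁ hθ)
    _ = K * ν₂ * (2 * ν₁ / (ν₁ - ν₂)) := by
        field_simp
        ring

/-- Richardson-in-`ν` with a second-order expansion: if `|gᵢ - gE - a νᵢ| ≤ B νᵢ²` at `0 < ν₂ < ν₁`, the
linear term cancels exactly in the extrapolant and the error is certified to `B ν₁ ν₂ (ν₁ + ν₂)/(ν₁ - ν₂)`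
(= `6 B ν₂²` at factor-2 spacing). -/
theorem extrapolant_error_of_expansion {a B ν₁ ν₂ g₁ g₂ gE : ℝ} (h₂ : 0 < ν₂) (h₁₂ : ν₂ < ν₁)
    (e₁ : |g₁ - gE - a * ν₁| ≤ B * ν₁ ^ 2) (e₂ : |g₂ - gE - a * ν₂| ≤ B * ν₂ ^ 2) :
    |g₂ + (g₂ - g₁) * (ν₂ / (ν₁ - ν₂)) - gE| ≤ B * ν₁ * ν₂ * ((ν₁ + ν₂) / (ν₁ - ν₂)) := by
  have hd : 0 < ν₁ - ν₂ := sub_pos.mpr h₁₂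
  have hθ : 0 ≤ ν₂ / (ν₁ - ν₂) := div_nonneg h₂.le hd.le
  have hid : g₂ + (g₂ - g₁) * (ν₂ / (ν₁ - ν₂)) - gE
      = (1 + ν₂ / (ν₁ - ν₂)) * (g₂ - gE - a * ν₂) - (ν₂ / (ν₁ - ν₂)) * (g₁ - gE - a * ν₁) := by
    field_simp
    ring
  rw [hid]
  calc |(1 + ν₂ / (ν₁ - ν₂)) * (g₂ - gE - a * ν₂) - (ν₂ / (ν₁ - ν₂)) * (g₁ - gE - a * ν₁)|
      ≤ |(1 + ν₂ / (ν₁ - ν₂)) * (g₂ - gE - a * ν₂)| + |(ν₂ / (ν₁ - ν₂)) * (g₁ - gE - a * ν₁)| := abs_sub _ _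
    _ = (1 + ν₂ / (ν₁ - ν₂)) * |g₂ - gE - a * ν₂| + (ν₂ / (ν₁ - ν₂)) * |g₁ - gE - a * ν₁| := by
        rw [abs_mul, abs_mul, abs_of_nonneg (by linarith), abs_of_nonneg hθ]
    _ ≤ (1 + ν₂ / (ν₁ - ν₂)) * (B * ν₂ ^ 2) + (ν₂ / (ν₁ - ν₂)) * (B * ν₁ ^ 2) :=
        add_le_add (mul_le_mul_of_nonneg_left e₂ (by linarith)) (mul_le_mul_of_nonneg_left e₁ hθ)
    _ = B * ν₁ * ν₂ * ((ν₁ + ν₂) / (ν₁ - ν₂)) := by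
        field_simp
        ring

end Richardson

end Summit.NavierStokesRegularity.FluidComputer.InviscidCeiling
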